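import Literature.Computability.AlgebraicComplexity.GroupTheoreticMatMul
import Literature.Combinatorics.Additive.TightTriangleRemovalProofs

/-!
# ω-census, the pattern `(2,2,2)²`: symmetries of CKSU Def. 5.1 and the normal form

HONEST FRAMING (pub-omega census; verbatim): lottery ticket; floor = certified bounds/negative ranges.
Census STRUCTURE bookkeeping (question Q7, row `k = 2`), not progress on `ω`.

Elementary symmetries of the tree's `IsSTPP` used by the kernel non-existence proofs (`STPP222SqCover.lean`):
per-triple translation together with global shifts of the `B`- and `C`-rows (`isSTPP_translate`), negate-and-swap
(`isSTPP_negSwap`) and the role swap `B ↔ C` (`isSTPP_swapBC`, via the tree's `IsSTPP.image` with `x ↦ -x`), and the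
NORMAL FORM `exists_nf` (membership version: after translating, `0 ∈ A 0, A 1, B 0, C 0` with prescribed second elements).

References: H. Cohn, R. Kleinberg, B. Szegedy, C. Umans, FOCS 2005 (arXiv:math/0511460), Def. 5.1.
Record: pub-omega HOME `pub-omega-eng2/results/c4red/K2-THRESHOLD-eng2.md` §NEG (ENG2 gen 17, 2026-08-23).
-/

open Literature.Computability.AlgebraicComplexity Finset

namespace Summit.MatrixMultiplication.OmegaCensus

namespace STPP222SqNeg

/-! ## 1. Symmetries of Def. 5.1 -/

/-- Per-triple translation (all three sets of triple `t` by `g t`) combined with global shifts of the `B`-row by `β` and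
of the `C`-row by `γ` preserves the STPP. [cite: CohnKleinbergSzegedyUmans2005, Def. 5.1] -/
theorem isSTPP_translate {G : Type} [AddCommGroup G] [DecidableEq G] {N : ℕ} {A B C : Fin N → Finset G}
    (hS : IsSTPP A B C) (g : Fin N → G) (β γ : G) :
    IsSTPP (fun t => (A t).image (· - g t)) (fun t => (B t).image (· - (g t + β)))
      (fun t => (C t).image (· - (g t + γ))) := by
  intro i j k s hs s' hs' t ht t' ht' u hu u' hu' h0
  simp only [Finset.mem_image] at hs hs' ht ht' hu hu'
  obtain ⟨s, hs, rfl⟩ := hs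
  obtain ⟨s', hs', rfl⟩ := hs'
  obtain ⟨t, ht, rfl⟩ := ht
  obtain ⟨t', ht', rfl⟩ := ht'
  obtain ⟨u, hu, rfl⟩ := hu
  obtain ⟨u', hu', rfl⟩ := hu'
  have h0' : (s' - s) + (t' - t) + (u' - u) = 0 := by
    rw [← h0]; abel
  obtain ⟨hij, hjk, e1, e2, e3⟩ := hS i j k s hs s' hs' t ht t' ht' u hu u' hu' h0'
  subst hij; subst hjk
  exact ⟨rfl, rfl, by rw [e1], by rw [e2], by rw [e3]⟩

/-- Negating all sets and exchanging the roles of `B` and `C` preserves the STPP.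
[cite: CohnKleinbergSzegedyUmans2005, Def. 5.1] -/
theorem isSTPP_negSwap {G : Type} [AddCommGroup G] [DecidableEq G] {N : ℕ} {A B C : Fin N → Finset G}
    (hS : IsSTPP A B C) :
    IsSTPP (fun t => (A t).image Neg.neg) (fun t => (C t).image Neg.neg) (fun t => (B t).image Neg.neg) := by
  intro i j k s hs s' hs' t ht t' ht' u hu u' hu' h0
  simp only [Finset.mem_image] at hs hs' ht ht' hu hu'
  obtain ⟨σ, hσ, rfl⟩ := hs
  obtain ⟨σ', hσ', rfl⟩ := hs'
  obtain ⟨τ, hτ, rfl⟩ := ht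
  obtain ⟨τ', hτ', rfl⟩ := ht'
  obtain ⟨υ, hυ, rfl⟩ := hu
  obtain ⟨υ', hυ', rfl⟩ := hu'
  have h0' : (σ - σ') + (υ - υ') + (τ - τ') = 0 := by
    rw [← h0]; abel
  obtain ⟨hkj, hji, e1, e2, e3⟩ := hS k j i σ' hσ' σ hσ υ' hυ' υ hυ τ' hτ' τ hτ h0'
  subst hkj; subst hji
  exact ⟨rfl, rfl, by rw [e1], by rw [e3], by rw [e2]⟩

/-- Exchanging the roles of `B` and `C` preserves the STPP (negate-and-swap, then the automorphism `x ↦ -x`).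
[cite: CohnKleinbergSzegedyUmans2005, Def. 5.1] -/
theorem isSTPP_swapBC {G : Type} [AddCommGroup G] [DecidableEq G] {N : ℕ} {A B C : Fin N → Finset G}
    (hS : IsSTPP A B C) : IsSTPP A C B := by
  have h := (isSTPP_negSwap hS).image (-(AddMonoidHom.id G)) neg_injective
  have e : ∀ S : Finset G, (S.image Neg.neg).image (⇑(-(AddMonoidHom.id G))) = S := fun S => by
    rw [Finset.image_image]
    convert Finset.image_id (s := S) using 2
    funext x; simp
  simp only [e] at h
  exact h

/-! ## 2. Normal form -/

/-- NORMAL FORM (membership version).  From an STPP configuration and chosen elements `x₀, x₁` of `A 0`, `y₀, y₁` of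
`A 1`, `m₀, m₁` of `B 0`, `n₀ ≠ n₁` of `B 1`, `o₀, o₁` of `C 0`, `p₀ ≠ p₁` of `C 1`, the translated configuration
(`isSTPP_translate` with `g = (x₀, y₀)`, `β = m₀ - x₀`, `γ = o₀ - x₀`) is an STPP configuration containing
`0, x₁ - x₀ ∈ A' 0`, `0, y₁ - y₀ ∈ A' 1`, `0, m₁ - m₀ ∈ B' 0`, two distinct `q, q' ∈ B' 1`, `0, o₁ - o₀ ∈ C' 0` and two
distinct `r, r' ∈ C' 1`.  The caller chooses the orientation (which element is subtracted).
[cite: CohnKleinbergSzegedyUmans2005, Def. 5.1] -/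
theorem exists_nf {G : Type} [AddCommGroup G] [DecidableEq G] {A B C : Fin 2 → Finset G} (hS : IsSTPP A B C)
    {x₀ x₁ y₀ y₁ m₀ m₁ n₀ n₁ o₀ o₁ p₀ p₁ : G} (hx₀ : x₀ ∈ A 0) (hx₁ : x₁ ∈ A 0) (hy₀ : y₀ ∈ A 1) (hy₁ : y₁ ∈ A 1)
    (hm₀ : m₀ ∈ B 0) (hm₁ : m₁ ∈ B 0) (hn₀ : n₀ ∈ B 1) (hn₁ : n₁ ∈ B 1) (hn : n₀ ≠ n₁)
    (ho₀ : o₀ ∈ C 0) (ho₁ : o₁ ∈ C 0) (hp₀ : p₀ ∈ C 1) (hp₁ : p₁ ∈ C 1) (hp : p₀ ≠ p₁) :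
    ∃ A' B' C' : Fin 2 → Finset G, ∃ q q' r r' : G, IsSTPP A' B' C' ∧
      (0 : G) ∈ A' 0 ∧ x₁ - x₀ ∈ A' 0 ∧ (0 : G) ∈ A' 1 ∧ y₁ - y₀ ∈ A' 1 ∧
      (0 : G) ∈ B' 0 ∧ m₁ - m₀ ∈ B' 0 ∧ q ∈ B' 1 ∧ q' ∈ B' 1 ∧ q ≠ q' ∧
      (0 : G) ∈ C' 0 ∧ o₁ - o₀ ∈ C' 0 ∧ r ∈ C' 1 ∧ r' ∈ C' 1 ∧ r ≠ r' := by
  let g : Fin 2 → G := ![x₀, y₀]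
  refine ⟨fun t => (A t).image (· - g t), fun t => (B t).image (· - (g t + (m₀ - x₀))),
    fun t => (C t).image (· - (g t + (o₀ - x₀))), n₀ - (y₀ + (m₀ - x₀)), n₁ - (y₀ + (m₀ - x₀)),
    p₀ - (y₀ + (o₀ - x₀)), p₁ - (y₀ + (o₀ - x₀)), isSTPP_translate hS g _ _, ?_, ?_, ?_, ?_, ?_, ?_, ?_, ?_, ?_, ?_, ?_,
    ?_, ?_, ?_⟩
  · exact Finset.mem_image.2 ⟨x₀, hx₀, by simp [g]⟩
  · exact Finset.mem_image.2 ⟨x₁, hx₁, by simp [g]⟩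
  · exact Finset.mem_image.2 ⟨y₀, hy₀, by simp [g]⟩
  · exact Finset.mem_image.2 ⟨y₁, hy₁, by simp [g]⟩
  · exact Finset.mem_image.2 ⟨m₀, hm₀, by simp [g]⟩
  · exact Finset.mem_image.2 ⟨m₁, hm₁, by simp [g]⟩
  · exact Finset.mem_image.2 ⟨n₀, hn₀, by simp [g]⟩
  · exact Finset.mem_image.2 ⟨n₁, hn₁, by simp [g]⟩
  · exact fun h => hn (sub_left_injective h)
  · exact Finset.mem_image.2 ⟨o₀, ho₀, by simp [g]⟩
  · exact Finset.mem_image.2 ⟨o₁, ho₁, by simp [g]⟩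
  · exact Finset.mem_image.2 ⟨p₀, hp₀, by simp [g]⟩
  · exact Finset.mem_image.2 ⟨p₁, hp₁, by simp [g]⟩
  · exact fun h => hp (sub_left_injective h)

end STPP222SqNeg

end Summit.MatrixMultiplication.OmegaCensus
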